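import Literature.Analysis.ValidatedNumerics.MultiPrecisionInterval
import HarnessLib

/-!
# Interval polynomials over the multi-precision fixed-point intervals `MI`

Trunk T-ANA (Analysis/ValidatedNumerics); namespace `Literature.Analysis.ValidatedNumerics.PolyMP`.
A small kernel- or native-checkable layer on top of `MultiPrecisionInterval.lean`
(`Literature.Analysis.ValidatedNumerics.NumericsMP.MI`, scale `S`): univariate polynomials with
interval coefficients, their arithmetic, and a *sign checker* on an interval, each operation with
an inclusion theorem against a real "shadow" (coefficient lists over `ℝ`, Horner evaluation).
This is the standard branch-and-bound of validated numerics (interval Horner evaluation, Taylor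
shift to the midpoint + absolute tail bound, bisection); it was written for the computer-assisted
part of the `γ = 5/3` implosion theorem of Buckmaster–Cao-Labora–Gómez-Serrano (Forum Math. Pi 13
(2025) e6, App. B does the same in Arb) but is problem-independent.

Contents (all computable over `ℤ`):
* real coefficient lists `evalR`, `addR`, `smulR`, `mulR`, `shiftR`, `derR`, `absBoundR` and the
  evaluation homomorphisms (`evalR_addR`, `evalR_mulR`, `evalR_shiftR`, `hasDerivAt_evalR`,
  `abs_evalR_le_absBoundR`);
* interval polynomials `IPoly = List MI`: `addI`, `smulI`, `smulIntI`, `sdivNatI`, `mulI`, `shiftI`,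
  `derI`, `absBoundI`, `ofRat`, with `PMem S as P` (coefficientwise membership) and inclusion theorems
  `pmem_*`;
* the sign checker `posOn S depth P lo hi` and its soundness `posOn_sound`: every real polynomial
  whose coefficients lie in `P` is positive on `[lo, hi]`; `negOn` likewise.
No facts, no axioms.

## References

* R. E. Moore, *Interval Analysis*, Prentice-Hall 1966, Ch. 3 (interval polynomial evaluation,
  subdivision). [folklore]
* T. Buckmaster, G. Cao-Labora, J. Gómez-Serrano, *Smooth imploding solutions for 3D compressible
  fluids*, Forum Math. Pi 13 (2025) e6, Appendix B (the same branch-and-bound in Arb).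
  [cite: BuckmasterCaolaboraGomezserrano2025, Appendix B]
-/

namespace Literature.Analysis.ValidatedNumerics

namespace PolyMP

open Literature.Analysis.ValidatedNumerics.NumericsMP

/-! ### Real coefficient lists (the shadow) -/

/-- Horner evaluation `a₀ + x(a₁ + x(a₂ + …))` of a coefficient list. [folklore] -/
noncomputable def evalR : List ℝ → ℝ → ℝ
  | [], _ => 0
  | a :: as, x => a + x * evalR as x

/-- [folklore] -/
@[simp] theorem evalR_nil (x : ℝ) : evalR [] x = 0 := rfl

/-- [folklore] -/
@[simp] theorem evalR_cons (a : ℝ) (as : List ℝ) (x : ℝ) :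
    evalR (a :: as) x = a + x * evalR as x := rfl

/-- Coefficientwise sum (lists of possibly different lengths). [folklore] -/
noncomputable def addR : List ℝ → List ℝ → List ℝ
  | [], bs => bs
  | a :: as, [] => a :: as
  | a :: as, b :: bs => (a + b) :: addR as bs

/-- [folklore] -/
theorem evalR_addR : ∀ (as bs : List ℝ) (x : ℝ), evalR (addR as bs) x = evalR as x + evalR bs x
  | [], bs, x => by simp [addR]
  | a :: as, [], x => by simp [addR]
  | a :: as, b :: bs, x => by
      simp only [addR, evalR_cons, evalR_addR as bs x]; ring

/-- Scalar multiple. [folklore] -/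
noncomputable def smulR (c : ℝ) (as : List ℝ) : List ℝ := as.map (c * ·)

/-- [folklore] -/
theorem evalR_smulR (c : ℝ) : ∀ (as : List ℝ) (x : ℝ), evalR (smulR c as) x = c * evalR as x
  | [], x => by simp [smulR]
  | a :: as, x => by
      have := evalR_smulR c as x
      simp only [smulR, List.map_cons, evalR_cons] at this ⊢
      rw [this]; ring

/-- Product: `(a + x·p)·q = a·q + x·(p·q)`. [folklore] -/
noncomputable def mulR : List ℝ → List ℝ → List ℝ
  | [], _ => []
  | a :: as, bs => addR (smulR a bs) (0 :: mulR as bs)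

/-- [folklore] -/
theorem evalR_mulR : ∀ (as bs : List ℝ) (x : ℝ), evalR (mulR as bs) x = evalR as x * evalR bs x
  | [], bs, x => by simp [mulR]
  | a :: as, bs, x => by
      simp only [mulR, evalR_addR, evalR_smulR, evalR_cons, evalR_mulR as bs x]; ring

/-- One Horner step of the Taylor shift: `a + (c + y)·acc(y)`. [folklore] -/
noncomputable def shiftStepR (c a : ℝ) (acc : List ℝ) : List ℝ :=
  addR [a] (addR (smulR c acc) (0 :: acc))

/-- Taylor shift: the coefficients (in `y`) of `p(c + y)`. [folklore] -/
noncomputable def shiftR (as : List ℝ) (c : ℝ) : List ℝ :=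
  as.foldr (shiftStepR c) []

/-- [folklore] -/
theorem evalR_shiftStepR (c a : ℝ) (acc : List ℝ) (y : ℝ) :
    evalR (shiftStepR c a acc) y = a + (c + y) * evalR acc y := by
  simp only [shiftStepR, evalR_addR, evalR_smulR, evalR_cons, evalR_nil]; ring

/-- [folklore] -/
theorem evalR_shiftR (c : ℝ) : ∀ (as : List ℝ) (y : ℝ), evalR (shiftR as c) y = evalR as (c + y)
  | [], y => by simp [shiftR]
  | a :: as, y => by
      have h := evalR_shiftR c as y
      simp only [shiftR, List.foldr_cons] at h ⊢
      rw [evalR_shiftStepR, h, evalR_cons]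

/-- Absolute tail bound `|a₀| + h(|a₁| + h(…))`. [folklore] -/
noncomputable def absBoundR : List ℝ → ℝ → ℝ
  | [], _ => 0
  | a :: as, h => |a| + h * absBoundR as h

/-- [folklore] -/
theorem absBoundR_nonneg : ∀ (as : List ℝ) {h : ℝ}, 0 ≤ h → 0 ≤ absBoundR as h
  | [], _, _ => le_rfl
  | a :: as, h, hh => by
      have := absBoundR_nonneg as hh
      simp only [absBoundR]; positivity

/-- `|p(y)| ≤ absBound(p, h)` for `|y| ≤ h`. [folklore] -/
theorem abs_evalR_le_absBoundR : ∀ (as : List ℝ) {y h : ℝ}, |y| ≤ h → |evalR as y| ≤ absBoundR as h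
  | [], y, h, _ => by simp [absBoundR]
  | a :: as, y, h, hy => by
      have hh : 0 ≤ h := (abs_nonneg y).trans hy
      have ih := abs_evalR_le_absBoundR as hy
      have hb := absBoundR_nonneg as hh
      simp only [evalR_cons, absBoundR]
      calc |a + y * evalR as y| ≤ |a| + |y * evalR as y| := abs_add_le _ _
        _ = |a| + |y| * |evalR as y| := by rw [abs_mul]
        _ ≤ |a| + h * absBoundR as h := by gcongr

/-! ### Interval polynomials -/

/-- Interval polynomials: lists of `MI` coefficients. [folklore] -/
abbrev IPoly := List MI

/-- Coefficientwise membership of a real coefficient list in an interval polynomial. [folklore] -/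
def PMem (S : ℕ) (as : List ℝ) (P : IPoly) : Prop := List.Forall₂ (fun a I => MI.mem S a I) as P

/-- [folklore] -/
theorem pmem_nil (S : ℕ) : PMem S [] [] := List.Forall₂.nil

/-- [folklore] -/
theorem pmem_cons {S : ℕ} {a : ℝ} {I : MI} {as : List ℝ} {P : IPoly} (h : MI.mem S a I)
    (hs : PMem S as P) : PMem S (a :: as) (I :: P) := List.Forall₂.cons h hs

/-- Coefficientwise interval sum. [folklore] -/
def addI : IPoly → IPoly → IPoly
  | [], Q => Q
  | I :: P, [] => I :: P
  | I :: P, J :: Q => MI.add I J :: addI P Q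

/-- [folklore] -/
theorem pmem_addI {S : ℕ} : ∀ {as bs : List ℝ} {P Q : IPoly}, PMem S as P → PMem S bs Q →
    PMem S (addR as bs) (addI P Q)
  | _, _, _, _, List.Forall₂.nil, hQ => by simpa [addR, addI] using hQ
  | _, _, _, _, List.Forall₂.cons (a := a) (b := I) (l₁ := as) (l₂ := P) ha hP, List.Forall₂.nil => by
      simp only [addR, addI]
      exact List.Forall₂.cons ha hP
  | _, _, _, _, List.Forall₂.cons (a := a) (b := I) ha hP, List.Forall₂.cons (a := b) (b := J) hb hQ => by
      simp only [addR, addI]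
      exact List.Forall₂.cons (MI.mem_add ha hb) (pmem_addI hP hQ)

/-- Interval scalar multiple. [folklore] -/
def smulI (S : ℕ) (c : MI) (P : IPoly) : IPoly := P.map (MI.mul S c)

/-- [folklore] -/
theorem pmem_smulI {S : ℕ} (hS : 0 < S) {c : ℝ} {C : MI} (hc : MI.mem S c C) :
    ∀ {as : List ℝ} {P : IPoly}, PMem S as P → PMem S (smulR c as) (smulI S C P)
  | _, _, List.Forall₂.nil => by simpa [smulR, smulI] using pmem_nil S
  | _, _, List.Forall₂.cons (a := a) (b := I) ha hP => by
      simp only [smulR, smulI, List.map_cons]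
      exact List.Forall₂.cons (MI.mem_mul hS hc ha) (pmem_smulI hS hc hP)

/-- Interval polynomial product. [folklore] -/
def mulI (S : ℕ) : IPoly → IPoly → IPoly
  | [], _ => []
  | I :: P, Q => addI (smulI S I Q) (MI.ofInt S 0 :: mulI S P Q)

/-- [folklore] -/
theorem pmem_mulI {S : ℕ} (hS : 0 < S) : ∀ {as bs : List ℝ} {P Q : IPoly}, PMem S as P → PMem S bs Q →
    PMem S (mulR as bs) (mulI S P Q)
  | _, _, _, _, List.Forall₂.nil, _ => by simpa [mulR, mulI] using pmem_nil S
  | _, _, _, _, List.Forall₂.cons (a := a) (b := I) ha hP, hQ => by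
      simp only [mulR, mulI]
      refine pmem_addI (pmem_smulI hS ha hQ) (pmem_cons ?_ (pmem_mulI hS hP hQ))
      simpa using MI.mem_ofInt S 0

/-- One Horner step of the interval Taylor shift. [folklore] -/
def shiftStepI (S : ℕ) (c I : MI) (acc : IPoly) : IPoly :=
  addI [I] (addI (smulI S c acc) (MI.ofInt S 0 :: acc))

/-- Interval Taylor shift. [folklore] -/
def shiftI (S : ℕ) (P : IPoly) (c : MI) : IPoly := P.foldr (shiftStepI S c) []

/-- [folklore] -/
theorem pmem_shiftStepI {S : ℕ} (hS : 0 < S) {c a : ℝ} {C I : MI} (hc : MI.mem S c C) (ha : MI.mem S a I)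
    {acc : List ℝ} {A : IPoly} (h : PMem S acc A) :
    PMem S (shiftStepR c a acc) (shiftStepI S C I A) := by
  unfold shiftStepR shiftStepI
  refine pmem_addI (pmem_cons ha (pmem_nil S)) (pmem_addI (pmem_smulI hS hc h) (pmem_cons ?_ h))
  simpa using MI.mem_ofInt S 0

/-- [folklore] -/
theorem pmem_shiftI {S : ℕ} (hS : 0 < S) {c : ℝ} {C : MI} (hc : MI.mem S c C) :
    ∀ {as : List ℝ} {P : IPoly}, PMem S as P → PMem S (shiftR as c) (shiftI S P C)
  | _, _, List.Forall₂.nil => by simpa [shiftR, shiftI] using pmem_nil S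
  | _, _, List.Forall₂.cons (a := a) (b := I) (l₁ := as) (l₂ := P) ha hP => by
      have ih := pmem_shiftI hS hc hP
      simp only [shiftR, shiftI, List.foldr_cons] at ih ⊢
      exact pmem_shiftStepI hS hc ha ih

/-- Scaled integer upper bound of `absBoundR as (hn/hd) · S` (outward rounded Horner). [folklore] -/
def absBoundI (S : ℕ) (hn : ℤ) (hd : ℕ) : IPoly → ℤ
  | [] => 0
  | I :: P => MI.absHi I + Numerics.cdiv (hn * absBoundI S hn hd P) hd

/-- [folklore] -/
theorem absBoundR_le_absBoundI {S : ℕ} {hn : ℤ} {hd : ℕ} (hn0 : 0 ≤ hn) (hd0 : 0 < hd) :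
    ∀ {as : List ℝ} {P : IPoly}, PMem S as P →
      absBoundR as ((hn : ℝ) / hd) * S ≤ (absBoundI S hn hd P : ℝ)
  | _, _, List.Forall₂.nil => by simp [absBoundR, absBoundI]
  | _, _, List.Forall₂.cons (a := a) (b := I) (l₁ := as) (l₂ := P) ha hP => by
      have ih := absBoundR_le_absBoundI hn0 hd0 hP
      have hdr : (0 : ℝ) < hd := by exact_mod_cast hd0
      have hdz : (0 : ℤ) < hd := by exact_mod_cast hd0
      have hnr : (0 : ℝ) ≤ hn := by exact_mod_cast hn0
      have h1 := MI.abs_le_absHi ha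
      have h2 := Numerics.le_cdiv_mul_real (a := hn * absBoundI S hn hd P) hdz
      simp only [absBoundR, absBoundI, Int.cast_add]
      have hb : 0 ≤ absBoundR as ((hn : ℝ) / hd) :=
        absBoundR_nonneg as (div_nonneg hnr hdr.le)
      -- `(hn/hd) * B * S ≤ cdiv(hn * BI, hd)` from `B * S ≤ BI`
      have h3 : (hn : ℝ) / hd * absBoundR as ((hn : ℝ) / hd) * S ≤
          ((Numerics.cdiv (hn * absBoundI S hn hd P) hd : ℤ) : ℝ) := by
        have h4 : (hn : ℝ) * (absBoundR as ((hn : ℝ) / hd) * S) ≤ (hn : ℝ) * (absBoundI S hn hd P : ℝ) :=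
          mul_le_mul_of_nonneg_left ih hnr
        have h5 : ((hn * absBoundI S hn hd P : ℤ) : ℝ) ≤
            ((Numerics.cdiv (hn * absBoundI S hn hd P) hd : ℤ) : ℝ) * hd := by exact_mod_cast h2
        rw [div_mul_eq_mul_div, div_mul_eq_mul_div, div_le_iff₀ hdr]
        push_cast at h5
        nlinarith
      nlinarith

/-! ### The sign checker -/

/-- Core test on one interval: Taylor-shift to the midpoint and compare the constant coefficient
with the absolute bound of the tail. [folklore] -/
def posCore (S : ℕ) (P : IPoly) (lo hi : ℚ) : Bool :=
  let mid : ℚ := (lo + hi) / 2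
  let hw : ℚ := (hi - lo) / 2
  match shiftI S P (MI.ofFrac S mid.num mid.den) with
  | [] => false
  | s0 :: tail => decide (Numerics.cdiv (hw.num * absBoundI S hw.num hw.den tail) hw.den < s0.lo)

/-- Positivity checker with bisection to depth `d`. [folklore] -/
def posOn (S : ℕ) : ℕ → IPoly → ℚ → ℚ → Bool
  | 0, P, lo, hi => posCore S P lo hi
  | d + 1, P, lo, hi =>
      posCore S P lo hi || (posOn S d P lo ((lo + hi) / 2) && posOn S d P ((lo + hi) / 2) hi)

/-- Negativity checker: positivity of the negated polynomial. [folklore] -/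
def negOn (S : ℕ) (d : ℕ) (P : IPoly) (lo hi : ℚ) : Bool := posOn S d (P.map MI.neg) lo hi

/-- A rational as a real is the quotient of its numerator and denominator. [folklore] -/
theorem ratCast_eq_num_div_den (q : ℚ) : (q : ℝ) = (q.num : ℝ) / (q.den : ℝ) := Rat.cast_def q

/-- Soundness of the core test. [folklore] -/
theorem posCore_sound {S : ℕ} (hS : 0 < S) {P : IPoly} {lo hi : ℚ} (h : posCore S P lo hi = true)
    (hle : lo ≤ hi) {as : List ℝ} (has : PMem S as P) {x : ℝ} (hlo : (lo : ℝ) ≤ x) (hhi : x ≤ hi) :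
    0 < evalR as x := by
  set mid : ℚ := (lo + hi) / 2 with hmid
  set hw : ℚ := (hi - lo) / 2 with hhw
  have hmidR : ((mid : ℚ) : ℝ) = ((lo : ℝ) + hi) / 2 := by rw [hmid]; push_cast; ring
  have hhwR : ((hw : ℚ) : ℝ) = ((hi : ℝ) - lo) / 2 := by rw [hhw]; push_cast; ring
  have hc : MI.mem S ((mid : ℚ) : ℝ) (MI.ofFrac S mid.num mid.den) := by
    rw [ratCast_eq_num_div_den]; exact MI.mem_ofFrac S mid.num mid.pos
  have hsh := pmem_shiftI hS hc has
  unfold posCore at h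
  simp only [← hmid] at h
  generalize hsp : shiftI S P (MI.ofFrac S mid.num mid.den) = SP at h hsh
  match SP, hsh, h with
  | [], hsh, h => simp at h
  | s0 :: tail, hsh, h =>
    have hdec := of_decide_eq_true h
    -- destructure the membership of the shifted list
    generalize hsr : shiftR as ((mid : ℚ) : ℝ) = SR at hsh
    match SR, hsh with
    | a0 :: tR, List.Forall₂.cons ha0 htail =>
      have hev : evalR as x = evalR (a0 :: tR) (x - mid) := by
        rw [← hsr, evalR_shiftR]; congr 1; ring
      rw [hev, evalR_cons]
      have hy : |x - mid| ≤ ((hw : ℚ) : ℝ) := by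
        rw [hmidR, hhwR, abs_le]; constructor <;> linarith
      have hwnn : 0 ≤ hw := by rw [hhw]; linarith
      have hn0 : 0 ≤ hw.num := Rat.num_nonneg.mpr hwnn
      have hB := absBoundR_le_absBoundI (S := S) hn0 hw.pos htail
      rw [← ratCast_eq_num_div_den] at hB
      have htl := abs_evalR_le_absBoundR tR hy
      have hSr : (0 : ℝ) < S := by exact_mod_cast hS
      have hdz : (0 : ℤ) < hw.den := by exact_mod_cast hw.pos
      have hcd := Numerics.le_cdiv_mul_real (a := hw.num * absBoundI S hw.num hw.den tail) hdz
      have hdecR : ((Numerics.cdiv (hw.num * absBoundI S hw.num hw.den tail) hw.den : ℤ) : ℝ) <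
          (s0.lo : ℝ) := by exact_mod_cast hdec
      have ha0m := ha0.1
      -- `hw * absBoundR * S ≤ cdiv(...)`
      have hwR : ((hw : ℚ) : ℝ) = (hw.num : ℝ) / hw.den := ratCast_eq_num_div_den hw
      have hdR : (0 : ℝ) < hw.den := by exact_mod_cast hw.pos
      have key : ((hw : ℚ) : ℝ) * absBoundR tR ((hw : ℚ) : ℝ) * S ≤
          ((Numerics.cdiv (hw.num * absBoundI S hw.num hw.den tail) hw.den : ℤ) : ℝ) := by
        have h5 : ((hw.num * absBoundI S hw.num hw.den tail : ℤ) : ℝ) ≤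
            ((Numerics.cdiv (hw.num * absBoundI S hw.num hw.den tail) hw.den : ℤ) : ℝ) * hw.den := by
          exact_mod_cast hcd
        push_cast at h5
        have hnr : (0 : ℝ) ≤ hw.num := by exact_mod_cast hn0
        have h4 : (hw.num : ℝ) * (absBoundR tR ((hw:ℚ):ℝ) * S) ≤ (hw.num : ℝ) * (absBoundI S hw.num hw.den tail : ℝ) :=
          mul_le_mul_of_nonneg_left hB hnr
        rw [hwR] at h4 ⊢
        rw [div_mul_eq_mul_div, div_mul_eq_mul_div, div_le_iff₀ hdR]
        have : (hw.num : ℝ) / hw.den = ((hw : ℚ) : ℝ) := hwR.symm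
        nlinarith [h4, h5]
      have hprod : |(x - mid) * evalR tR (x - mid)| ≤ ((hw : ℚ) : ℝ) * absBoundR tR ((hw : ℚ) : ℝ) := by
        rw [abs_mul]
        have hwnnR : (0 : ℝ) ≤ ((hw : ℚ) : ℝ) := by exact_mod_cast hwnn
        exact mul_le_mul hy htl (abs_nonneg _) hwnnR
      have habs := (abs_le.1 hprod).1
      -- combine: a0 * S ≥ s0.lo > cdiv ≥ hw*B*S ≥ -(y * tail) * S
      nlinarith [hprod, habs, key, hdecR, ha0m, hSr, (abs_le.1 hprod).2]

/-- **Soundness of the positivity checker.** [folklore] -/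
theorem posOn_sound {S : ℕ} (hS : 0 < S) : ∀ {d : ℕ} {P : IPoly} {lo hi : ℚ},
    posOn S d P lo hi = true → lo ≤ hi → ∀ {as : List ℝ}, PMem S as P →
      ∀ {x : ℝ}, (lo : ℝ) ≤ x → x ≤ hi → 0 < evalR as x
  | 0, P, lo, hi, h, hle, as, has, x, hlo, hhi => posCore_sound hS h hle has hlo hhi
  | d + 1, P, lo, hi, h, hle, as, has, x, hlo, hhi => by
      simp only [posOn, Bool.or_eq_true, Bool.and_eq_true] at h
      rcases h with h | ⟨h1, h2⟩
      · exact posCore_sound hS h hle has hlo hhi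
      · have hm1 : lo ≤ (lo + hi) / 2 := by linarith
        have hm2 : (lo + hi) / 2 ≤ hi := by linarith
        have hmR : (((lo + hi) / 2 : ℚ) : ℝ) = ((lo : ℝ) + hi) / 2 := by push_cast; ring
        rcases le_or_gt x (((lo : ℝ) + hi) / 2) with hx | hx
        · exact posOn_sound hS h1 hm1 has hlo (by rw [hmR]; exact hx)
        · exact posOn_sound hS h2 hm2 has (by rw [hmR]; exact hx.le) hhi

/-- [folklore] -/
theorem pmem_neg {S : ℕ} : ∀ {as : List ℝ} {P : IPoly}, PMem S as P →
    PMem S (as.map Neg.neg) (P.map MI.neg)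
  | _, _, List.Forall₂.nil => by simpa using pmem_nil S
  | _, _, List.Forall₂.cons ha hP => by
      simp only [List.map_cons]
      exact List.Forall₂.cons (MI.mem_neg ha) (pmem_neg hP)

/-- [folklore] -/
theorem evalR_map_neg : ∀ (as : List ℝ) (x : ℝ), evalR (as.map Neg.neg) x = -evalR as x
  | [], x => by simp
  | a :: as, x => by simp only [List.map_cons, evalR_cons, evalR_map_neg as x]; ring

/-- **Soundness of the negativity checker.** [folklore] -/
theorem negOn_sound {S : ℕ} (hS : 0 < S) {d : ℕ} {P : IPoly} {lo hi : ℚ}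
    (h : negOn S d P lo hi = true) (hle : lo ≤ hi) {as : List ℝ} (has : PMem S as P)
    {x : ℝ} (hlo : (lo : ℝ) ≤ x) (hhi : x ≤ hi) : evalR as x < 0 := by
  have := posOn_sound hS h hle (pmem_neg has) hlo hhi
  rw [evalR_map_neg] at this
  linarith

/-! ### Small helpers: integer and rational scalings, derivative -/

/-- Coefficientwise product with an integer. [folklore] -/
def smulIntI (k : ℤ) (P : IPoly) : IPoly := P.map (fun I => MI.mulInt I k)

/-- [folklore] -/
theorem pmem_smulIntI {S : ℕ} (k : ℤ) : ∀ {as : List ℝ} {P : IPoly}, PMem S as P →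
    PMem S (smulR (k : ℝ) as) (smulIntI k P)
  | _, _, List.Forall₂.nil => by simpa [smulR, smulIntI] using pmem_nil S
  | _, _, List.Forall₂.cons (a := a) (b := I) ha hP => by
      simp only [smulR, smulIntI, List.map_cons]
      refine List.Forall₂.cons ?_ (pmem_smulIntI k hP)
      have := MI.mem_mulInt ha k
      simpa [mul_comm] using this

/-- Coefficientwise division by a positive natural number. [folklore] -/
def sdivNatI (n : ℕ) (P : IPoly) : IPoly := P.map (fun I => MI.divNat I n)

/-- [folklore] -/
theorem pmem_sdivNatI {S : ℕ} {n : ℕ} (hn : 0 < n) : ∀ {as : List ℝ} {P : IPoly}, PMem S as P →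
    PMem S (smulR ((n : ℝ)⁻¹) as) (sdivNatI n P)
  | _, _, List.Forall₂.nil => by simpa [smulR, sdivNatI] using pmem_nil S
  | _, _, List.Forall₂.cons (a := a) (b := I) ha hP => by
      simp only [smulR, sdivNatI, List.map_cons]
      refine List.Forall₂.cons ?_ (pmem_sdivNatI hn hP)
      have := MI.mem_divNat ha hn
      simpa [div_eq_inv_mul] using this

/-- Formal derivative of a real coefficient list. [folklore] -/
noncomputable def derR : List ℝ → List ℝ
  | [] => []
  | _ :: as => addR as (0 :: derR as)  -- d/dx (a + x p) = p + x p'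

/-- [folklore] -/
theorem hasDerivAt_evalR : ∀ (as : List ℝ) (x : ℝ), HasDerivAt (evalR as) (evalR (derR as) x) x
  | [], x => by
      have h := hasDerivAt_const x (0 : ℝ)
      simp only [derR, evalR_nil]
      exact h.congr_of_eventuallyEq (Filter.Eventually.of_forall fun y => rfl)
  | a :: as, x => by
      have ih := hasDerivAt_evalR as x
      have h1 : HasDerivAt (fun y => a + y * evalR as y) (0 + (1 * evalR as x + x * evalR (derR as) x)) x :=
        (hasDerivAt_const x a).add ((hasDerivAt_id x).mul ih)
      have e : (fun y => a + y * evalR as y) = evalR (a :: as) := by funext y; rfl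
      rw [e] at h1
      convert h1 using 1
      simp only [derR, evalR_addR, evalR_cons]; ring

/-- Interval formal derivative. [folklore] -/
def derI : IPoly → IPoly
  | [] => []
  | _ :: P => addI P (⟨0, 0⟩ :: derI P)

/-- [folklore] -/
theorem pmem_derI {S : ℕ} : ∀ {as : List ℝ} {P : IPoly}, PMem S as P → PMem S (derR as) (derI P)
  | _, _, List.Forall₂.nil => by simpa [derR, derI] using pmem_nil S
  | _, _, List.Forall₂.cons (a := a) (b := I) ha hP => by
      simp only [derR, derI]
      refine pmem_addI hP (pmem_cons ?_ (pmem_derI hP))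
      simp [MI.mem]

/-- The thin interval of a rational number. [folklore] -/
def ofRat (S : ℕ) (q : ℚ) : MI := MI.ofFrac S q.num q.den

/-- [folklore] -/
theorem mem_ofRat (S : ℕ) (q : ℚ) : MI.mem S (q : ℝ) (ofRat S q) := by
  rw [ratCast_eq_num_div_den]; exact MI.mem_ofFrac S q.num q.pos

end PolyMP

end Literature.Analysis.ValidatedNumerics
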